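import Literature.NumberTheory.Rogawski1990.GlobalAPacketMembership                     -- ★ D6: `MemXiFamily`, `IsXiLocalFamily`, `LocalConstituentsIn`
import Summits.HodgeConjecture.HodgeConjecture.Theorems.F0P3FinRepConstituentsExist     -- ★ `isConstituentOf_finRepSmooth_comp_of_hasFinComponent`, `exists_isConstituentOf_comp_inclPlace`
import Literature.NumberTheory.Automorphic.IrreducibleClassesConstituentsIsotypic        -- ★ Σ♭ `IsConstituentOf.of_isotypicComponent_eq_top_comp`
import Literature.NumberTheory.Automorphic.IrreducibleClassesComap                       -- ★ `IrrClass.comap`, `comap_comap_symm`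
import HarnessLib

/-!
# FLOOR-0 P2 — PKΠ RUNG 4, stub LTY: THE LOCAL TYPES OF THE FINITE COMPONENT ARE `LocalConstituentsIn`-CONSTITUENTS (in-house, S)

Cell hodgecm-mathlib (D-0151), FLOOR 0, programme P2 (theta ∕ `hdictE`); crux item H413 = stmt-HodgeConjecture-24833 (`HCCMUnconditional.H413`);
F0P2-plan (g6) GEN-6 PLAN 2026-08-31T07:42:17Z «PKΠ RUNG 4 = RIG + DICT_n + DICT_split + ADAPT + LTY over D6 ED. 2» (sub-line
`Cruxes/H413/Lines/F0_P2PKPiRung4.lean`, being cut).  Seat F0P2-p01 (g5) (census `F0/P2/CENSUS-LTY-DICTsplit.F0P2p01g5.md`).  THEOREMS ONLY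
(no `def`, no instance, no notation, no named fact, no `sorry`); never imports a `Cruxes/…/Lines` module; `--supports stmt-HodgeConjecture-24833
--as helper`.  HC_CM is proved only modulo the printed citations until rung 0 closes; this file discharges none — it is the in-house row LTY
of the rung-4 road, assembled from ★ P3 rung-3 plumbing (I♭ ∕ Σ♭ ∕ T♭-core, (b2′) existence) and ★ D6.

WHAT LTY SAYS.  In PKΠ's telescope, `σ` (irreducible, smooth, admissible) is the finite component of the cotangent discrete `P` (`P.HasFinComponent σ`:
an injective equivariant `σ → P|_{U(H)(𝔸_f)}`), and S2♭ ★ `cohDiscrete_memXiFamily` puts `P` in a ξ-local family: `MemXiFamily P hH hHd μω hμu ξ = ∃ Pv,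
ξ.IsXiLocalFamily … Pv ∧ LocalConstituentsIn P Pv`, the second conjunct speaking of the constituents of `P.finRep^∞ ∘ inclPlace v`.  LTY moves this to
`σ` and to the irreducible LOCAL TYPES `τ_v` of `σ` (the objects of PKΠ's `IsoAt`):
* §1 **`exists_isXiLocalFamily_forall_constituent_mem`** (constituent currency): `MemXiFamily P … ξ`, `σ` smooth, `P.HasFinComponent σ` ⟹ `∃ Pv`,
  `ξ.IsXiLocalFamily … Pv` and EVERY constituent class of `σ ∘ inclPlace v` (read on `(cmDatum L 3 H).Local v` through ★ `localPiEquiv`) is a member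
  of `Pv v` — ★ `F0P3FinRepConstituentsExist.isConstituentOf_finRepSmooth_comp_of_hasFinComponent` (constituents of `σ_v` are constituents of
  `P.finRep^∞ ∘ inclPlace v`, because `σ ↪ P.finRep^∞`).
* §2 generic bridges (any topological group `G`): **`isConstituentOf_type_of_isotypicComponent_eq_top`** — if `ρ` is `τ`-isotypic
  (`isotypicComponent ℂ[G] ρ τ = ⊤`, `τ` irreducible) then every constituent class of `ρ` is a constituent class of `τ` (★ Σ♭ at `e = id`);
  **`nonempty_equiv_of_isConstituentOf_type`** — hence equivalent to `τ` (★ `IsConstituentOf.nonempty_equiv_of_isIrreducible`).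
* §3 **`exists_member_isConstituentOf_localType`** (local-type currency, the shape PKΠ consumes): `MemXiFamily P … ξ`, `σ` irreducible smooth,
  `P.HasFinComponent σ` ⟹ `∃ Pv`, `ξ.IsXiLocalFamily … Pv` and for every finite `v` and every irreducible `τ` with `σ ∘ inclPlace v` `τ`-isotypic
  THERE IS A MEMBER `c ∈ (Pv v).members` whose pull-back `IrrClass.comap (localPiEquiv v) c` is a constituent class of `τ` (hence its representatives
  are equivalent to `τ`, §2) — existence of a constituent of `σ_v` by ★ `F0P3FinRepConstituentsExist.exists_isConstituentOf_comp_inclPlace`.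
After RIG ∕ DICT_n ∕ DICT_split identify the member as `⟦X_v(μ_ξ, ε_v, χ_ξ) ∘ κ_v⁻¹⟧`, §2 gives `X_v(…) ∘ κ_v⁻¹ ≃ τ` and PKΠ's `IsoAt` follows by isotypy
transport (★ `F0P2eStubLRLocalReindex.isotypicComponent_comp_eq_top_iff_of_equiv`, Mathlib `LinearEquiv.isotypicComponent_eq`).

## References
* [Rogawski1990] J. Rogawski, Ann. of Math. Stud. 123 (1990): §13.1 p. 199, §13.3 p. 201, §14.6 p. 246.
* [FlathCorvallis1979] D. Flath, PSPM 33.1 (1979): Thm 3.  [BorelJacquet1979] A. Borel, H. Jacquet, PSPM 33.1 (1979): §4.6.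
* [BushnellHenniart2006] C. Bushnell, G. Henniart, Grundlehren 335 (2006): §1.1, §2.  [BourbakiAlgebreVIII2012] N. Bourbaki, Algèbre VIII: §4 n°2.
-/

set_option autoImplicit false
-- the mandated namespace has the single-problem summit's repeated segment (`HodgeConjecture.HodgeConjecture`)
set_option linter.dupNamespace false

noncomputable section

open scoped MonoidAlgebra Matrix
open MeasureTheory NumberField IsDedekindDomain

namespace Summit.HodgeConjecture.HodgeConjecture.Cruxes.H413.F0P2hLTYLocalConstituents

open Literature.NumberTheory.Automorphic Literature.NumberTheory.Automorphic.UnitaryGroup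
open Literature.NumberTheory.Rogawski1990
open Summit.HodgeConjecture.HodgeConjecture.Cruxes.H413.F0P3FinRepConstituentsExist

/-! ## §2 (first, generic) Constituents of an isotypic representation are its type -/

section Generic

variable {G : Type} [Group G] [TopologicalSpace G]

/-- **Every constituent class of a `τ`-isotypic representation `ρ` is a constituent class of `τ`** (`τ` irreducible): ★ Σ♭
`IrrClass.IsConstituentOf.of_isotypicComponent_eq_top_comp` along `e = id` (`ρ ∘ id = ρ`, `τ ∘ id = τ` by `MonoidHom.comp_id`).
[cite: BourbakiAlgebreVIII2012, VIII §4 n°2] [cite: BushnellHenniart2006, §2] -/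
theorem isConstituentOf_type_of_isotypicComponent_eq_top {V : Type*} [AddCommGroup V] [Module ℂ V] {T : Type*} [AddCommGroup T] [Module ℂ T]
    {ρ : Representation ℂ G V} {τ : Representation ℂ G T} [τ.IsIrreducible]
    (htop : isotypicComponent ℂ[G] ρ.asModule τ.asModule = ⊤) {c : IrrClass G} (hc : c.IsConstituentOf ρ) : c.IsConstituentOf τ := by
  haveI : IsSimpleModule ℂ[G] τ.asModule := (Representation.irreducible_iff_isSimpleModule_asModule τ).mp ‹_›
  have hc' : c.IsConstituentOf (ρ.comp (MonoidHom.id G)) := by rwa [MonoidHom.comp_id]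
  have h := hc'.of_isotypicComponent_eq_top_comp (σ := τ) htop (MonoidHom.id G)
  rwa [MonoidHom.comp_id] at h

/-- **A constituent class of a `τ`-isotypic representation is REALISED by a representation equivalent to `τ`**: for `⟦r⟧` a constituent of
the `τ`-isotypic `ρ` (`τ` irreducible), `r.ρ ≃ τ` (★ `IsConstituentOf.nonempty_equiv_of_isIrreducible`). [cite: BushnellHenniart2006, §1.1, §2] -/
theorem nonempty_equiv_of_isConstituentOf_type {V : Type*} [AddCommGroup V] [Module ℂ V] {T : Type*} [AddCommGroup T] [Module ℂ T]
    {ρ : Representation ℂ G V} {τ : Representation ℂ G T} [τ.IsIrreducible]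
    (htop : isotypicComponent ℂ[G] ρ.asModule τ.asModule = ⊤) {r : SmoothIrrep G} (hr : (IrrClass.mk r).IsConstituentOf ρ) :
    Nonempty (r.ρ.Equiv τ) :=
  (isConstituentOf_type_of_isotypicComponent_eq_top htop hr).nonempty_equiv_of_isIrreducible

end Generic

/-! ## §2b (generic frame `F E c N J`) a constituent of `σ_v` in `comap` currency, which is a constituent of the local type -/

section GenericFrame

variable {F E : Type} [Field F] [NumberField F] [Field E] [NumberField E] [Algebra F E] {c : E ≃ₐ[F] E} {N : ℕ}
  {J : Matrix (Fin N) (Fin N) E}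

/-- **A constituent of `σ ∘ inclPlace v` exists and is a constituent of any irreducible type `τ` of `σ ∘ inclPlace v`**, in the `comap`
currency of D6 (classes of `U(J)(F_v) = ↥(«local» E c N J v)` pulled back along ★ `localPiEquiv … v`): ★ (b2′)
`exists_isConstituentOf_comp_inclPlace` (`σ` irreducible smooth ⇒ `σ_v` smooth, non-zero) + §2 + ★ `IrrClass.comap_comap_symm`.
[cite: BushnellHenniart2006, §1.1, §2] [cite: FlathCorvallis1979, Thm 3] -/
theorem exists_comap_isConstituentOf_and_type {W : Type} [AddCommGroup W] [Module ℂ W]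
    {σ : Representation ℂ (finAdelic F E c N J) W} (hirr : σ.IsIrreducible) (hsm : σ.IsSmooth) (v : HeightOneSpectrum (𝓞 F))
    {T : Type*} [AddCommGroup T] [Module ℂ T] (τ : Representation ℂ (localPi E c N J v) T) [τ.IsIrreducible]
    (htop : isotypicComponent ℂ[localPi E c N J v] (Representation.asModule (σ.comp (inclPlace F E c N J v))) τ.asModule = ⊤) :
    ∃ c' : IrrClass ↥(«local» E c N J v),
      (IrrClass.comap (localPiEquiv E c N J v) c').IsConstituentOf (σ.comp (inclPlace F E c N J v)) ∧
        (IrrClass.comap (localPiEquiv E c N J v) c').IsConstituentOf τ := by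
  obtain ⟨c₀, hc₀⟩ := exists_isConstituentOf_comp_inclPlace hirr hsm v
  refine ⟨IrrClass.comap (localPiEquiv E c N J v).symm c₀, ?_, ?_⟩
  · rwa [IrrClass.comap_comap_symm]
  · rw [IrrClass.comap_comap_symm]
    exact isConstituentOf_type_of_isotypicComponent_eq_top htop hc₀

end GenericFrame

/-! ## §1 LTY in constituent currency -/

section CM

variable {L : Type} [Field L] [NumberField L] [IsCMField L] {H : Matrix (Fin 3) (Fin 3) L}
  {μ : Measure (adelicGroupData (↥(maximalRealSubfield L)) L (IsCMField.complexConj L) 3 H).automorphicQuotient}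
  [(adelicGroupData (↥(maximalRealSubfield L)) L (IsCMField.complexConj L) 3 H).IsAutomorphicMeasure μ]

/-- **LTY (constituent currency): a ξ-local family of `P` contains every local constituent of its finite component `σ`.**  If
`MemXiFamily P hH hHd μω hμu ξ` and the smooth `σ` occurs in `P` (`P.HasFinComponent σ`), then for the witnessing family `Pv` (an `IsXiLocalFamily`
of `ξ`): at every finite place `v` of `L⁺`, every class `c` of `(cmDatum L 3 H).Local v` whose pull-back along ★ `localPiEquiv … v` is a constituent of
`σ ∘ inclPlace v` is a member of `Pv v` — constituents of `σ_v` are constituents of `P.finRep^∞ ∘ inclPlace v` (★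
`isConstituentOf_finRepSmooth_comp_of_hasFinComponent`: `σ ↪ P.finRep^∞`), to which `LocalConstituentsIn` applies.
[cite: Rogawski1990, §13.1 p. 199, §14.6 p. 246] [cite: FlathCorvallis1979, Thm 3] [cite: BorelJacquet1979, §4.6] -/
theorem exists_isXiLocalFamily_forall_constituent_mem
    {hH : (H.map (cmConjRingHom L))ᵀ = H} {hHd : IsUnit H.det} {μω : Literature.NumberTheory.GaloisRepresentations.HeckeCharacter L}
    {hμu : μω.IsUnitary} {ξ : OneDimAutRepH L}
    (P : DiscreteAutomorphicRep (adelicGroupData (↥(maximalRealSubfield L)) L (IsCMField.complexConj L) 3 H) μ)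
    {W : Type} [AddCommGroup W] [Module ℂ W]
    {σ : Representation ℂ (finAdelic (↥(maximalRealSubfield L)) L (IsCMField.complexConj L) 3 H) W}
    (hsm : σ.IsSmooth) (hP : P.HasFinComponent σ) (h : MemXiFamily P hH hHd μω hμu ξ) :
    ∃ Pv : ∀ v : HeightOneSpectrum (𝓞 ↥(maximalRealSubfield L)), CMLocalAPacket L H v,
      ξ.IsXiLocalFamily hH hHd μω hμu Pv ∧
        ∀ (v : HeightOneSpectrum (𝓞 ↥(maximalRealSubfield L))) (c : IrrClass ((cmDatum L 3 H).Local v)),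
          (IrrClass.comap (localPiEquiv L (IsCMField.complexConj L) 3 H v) c).IsConstituentOf
              (σ.comp (inclPlace (↥(maximalRealSubfield L)) L (IsCMField.complexConj L) 3 H v)) →
            c ∈ (Pv v).members := by
  obtain ⟨Pv, hPv, hP'⟩ := h
  exact ⟨Pv, hPv, fun v c hc => hP' v c (isConstituentOf_finRepSmooth_comp_of_hasFinComponent P hsm hP hc)⟩

/-! ## §3 LTY in local-type currency (the shape PKΠ's `IsoAt` consumes) -/

/-- **LTY (local-type currency): every irreducible local type of the finite component is carried by a member of the ξ-local family.**  If
`MemXiFamily P hH hHd μω hμu ξ` and the irreducible smooth `σ` occurs in `P`, then for the witnessing `IsXiLocalFamily` `Pv`: at every finite `v`,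
for every irreducible `τ` on `T : Type` with `σ ∘ inclPlace v` `τ`-isotypic, there is a member `c ∈ (Pv v).members` whose pull-back
`IrrClass.comap (localPiEquiv … v) c` is a constituent class of `τ` (so each of its representatives is `≃ τ`, §2).  Proof: §1, a constituent `c₀` of
`σ_v` exists (★ `exists_isConstituentOf_comp_inclPlace`: `σ_v` is smooth and non-zero), it is a constituent of `τ` (§2), and
`c := comap (localPiEquiv v)⁻¹ c₀` (★ `IrrClass.comap_comap_symm`). [cite: Rogawski1990, §13.1 p. 199, §14.6 p. 246] [cite: FlathCorvallis1979, Thm 3]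
[cite: BushnellHenniart2006, §1.1, §2] -/
theorem exists_member_isConstituentOf_localType
    {hH : (H.map (cmConjRingHom L))ᵀ = H} {hHd : IsUnit H.det} {μω : Literature.NumberTheory.GaloisRepresentations.HeckeCharacter L}
    {hμu : μω.IsUnitary} {ξ : OneDimAutRepH L}
    (P : DiscreteAutomorphicRep (adelicGroupData (↥(maximalRealSubfield L)) L (IsCMField.complexConj L) 3 H) μ)
    {W : Type} [AddCommGroup W] [Module ℂ W]
    {σ : Representation ℂ (finAdelic (↥(maximalRealSubfield L)) L (IsCMField.complexConj L) 3 H) W}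
    (hirr : σ.IsIrreducible) (hsm : σ.IsSmooth) (hP : P.HasFinComponent σ) (h : MemXiFamily P hH hHd μω hμu ξ) :
    ∃ Pv : ∀ v : HeightOneSpectrum (𝓞 ↥(maximalRealSubfield L)), CMLocalAPacket L H v,
      ξ.IsXiLocalFamily hH hHd μω hμu Pv ∧
        ∀ (v : HeightOneSpectrum (𝓞 ↥(maximalRealSubfield L))) (T : Type) [AddCommGroup T] [Module ℂ T]
          (τ : Representation ℂ (localPi L (IsCMField.complexConj L) 3 H v) T), τ.IsIrreducible →
          isotypicComponent (MonoidAlgebra ℂ (localPi L (IsCMField.complexConj L) 3 H v))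
              (Representation.asModule (σ.comp (inclPlace (↥(maximalRealSubfield L)) L (IsCMField.complexConj L) 3 H v)))
              (Representation.asModule τ) = ⊤ →
            ∃ c : IrrClass ((cmDatum L 3 H).Local v), c ∈ (Pv v).members ∧
              (IrrClass.comap (localPiEquiv L (IsCMField.complexConj L) 3 H v) c).IsConstituentOf τ := by
  obtain ⟨Pv, hPv, hmem⟩ := exists_isXiLocalFamily_forall_constituent_mem P hsm hP h
  refine ⟨Pv, hPv, fun v T _ _ τ hτ htop => ?_⟩
  haveI := hτ
  obtain ⟨c', hcσ, hcτ⟩ := exists_comap_isConstituentOf_and_type hirr hsm v τ htop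
  exact ⟨c', hmem v c' hcσ, hcτ⟩

end CM

end Summit.HodgeConjecture.HodgeConjecture.Cruxes.H413.F0P2hLTYLocalConstituents

end
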